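import Mathlib.Analysis.Normed.Affine.AddTorsorBases
import Mathlib.Topology.MetricSpace.Thickening
import Literature.Topology.FourManifolds.CellularSets
import HarnessLib

/-!
# Stretching an open set across a simplex from a free face (Rushing, Exercise 1.6.12, one cell)

The elementary step of *"if `X ↘ Y` and `U ⊇ Y` is open, an ambient move supported near `X`
and fixed on what is already covered stretches `U` over `X`"* (Rushing, *Topological Embeddings*
(1973), Exercise 1.6.12; Zeeman's and Hudson's "regular neighbourhoods stretch over
collapses"), in the Euclidean, one-simplex, homeomorphism form that the engulfing arguments
(Rushing Thm. 4.2.1, and the chartwise steps `G₂` of the topological engulfing Thm. 4.12.1)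
consume:

* `exists_homeomorph_convexHull_subset_image` — let `T ⊆ E` (finite-dimensional real normed
  space) be affinely independent, `a ∈ T`, `B = T ∖ {a} ≠ ∅` the *free face*, `Δ = conv T`,
  `H = ⋃_{b ∈ B} conv (T ∖ {b})` the union of the facets through `a` (`= a * ∂B`; `Δ ↘ H` is the
  elementary collapse from `B`).  If `F` is closed with `F ∩ Δ ⊆ H`, `O ⊇ H` is open and `N ⊇ Δ`
  is open, there is `G : E ≃ₜ E` with `G = id` on `F`, `G = id` off a compact subset of `N`, and
  `Δ ⊆ G(O)`.
* `exists_homeomorph_coneSimplex_subset_image` — the same for the simplex `coneSimplex β i₀ IB`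
  with apex `β i₀` and base `β(IB)` cut out of an affine basis `β` of `E` (to which the vertex
  form reduces by extending `T` to an affine basis,
  `exists_subset_affineIndependent_affineSpan_eq_top`).

No isotopy is recorded (the engulfing applications towards the cell-engulfing form of the
topological Poincaré theorem only use the final homeomorphism); the move is visibly isotopic
to the identity through pushes of smaller strength, which is not formalised.

## Construction

Barycentric coordinates with respect to `β` split every point as
`x = β i₀ + coneW x + coneZ x` (`cone_decomp`): the *cone vector*
`coneW x = ∑_{i ∈ IB} βᵢ(x) (β i - β i₀)` and the *normal part* `coneZ x` (remaining directions);
the *level* `coneLev x = ∑_{i ∈ IB} βᵢ(x)` is `0` at the apex and `1` on the base, and the *depth*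
`coneMin x = min_{i ∈ IB} βᵢ(x)` vanishes exactly on the facets through the apex.  The move is a
**push along the cone lines** `x ↦ x + (Φ/L - 1) • coneW x` (`pushMap`), which multiplies the
base coordinates by `Φ/L` and keeps direction and normal part (`coord_add_smul_coneW`): the new
level `Φ = plProfile s₁ (2 s₁) s₃ v L` is the three-piece piecewise-linear profile of
`CellularSets` applied to the (clamped) level `L`, with value `v = (1 - λ) 2s₁ + λ vf` at `2 s₁`
interpolating between the identity (`λ = 0`) and the *full push* (`λ = 1`, level `2 s₁ ↦ vf > 1`,
i.e. a neighbourhood of the apex is blown over the whole simplex), the *strength*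
`λ = λ₁ λ₂ ∈ [0, 1]` being the product of a depth cutoff (`0` at depth `≤ θ`, `1` at depth
`≥ 2θ`, in terms of the direction `coneMin/coneLev`) and a normal cutoff (`1` for
`‖coneZ‖ ≤ ζ`, `0` for `‖coneZ‖ ≥ 2ζ`).  Since direction, normal part and hence strength are
invariant under pushes (`pushLam_push`), the push with the profile in which the roles of `2 s₁`
and `v` are exchanged is the inverse (`plProfile_plProfile_swap`, `pushMap_pushMap`), and both
are continuous (`continuous_plProfile_uncurry`, `continuous_plProfile_clamp_uncurry`), giving
`pushHomeomorph`.

Estimates: a moved point has level in `(s₁, s₃)`, depth `> θ ·` level and `‖coneZ‖ < 2ζ`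
(`moved_fwd`), hence lies within `(s₃ - 1) R₀ + 2ζ` (`R₀ = ∑ ‖β i - β i₀‖`) of the compact
**shadow set** of depth `θ s₁` (`shadowSet`, `exists_mem_shadowSet_dist_le`), which lies in `Δ`
and misses `H` (`shadowSet_subset_convexHull`, `notMem_facet_of_mem_shadowSet`), so is at
positive distance from `F` and from `E ∖ N`; and the inverse push carries every point of `Δ`
into a `κ`-neighbourhood of `H` (`pushMap_bwd_mem`: deep points are pulled back to level
`≤ 2 s₁`, within `2 s₁ R₀ < κ` of the apex; shallow points only lose depth and are within
`2 θ R₀ < κ` of the facet opposite to a deepest vertex, `mem_of_coneMin_lt`).  The parameters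
are then chosen in the order `κ` (thickening of `H` in `O`) → `s₁, θ` → shadow set →
`g` (thickening in `N ∖ F`) → `vf = 1 + mg`, `ζ`.

Everything is proved; the definitions (`coneLev`, `coneW`, `coneZ`, `coneMin`, `PushData`,
`pushLvl`, `pushLam₁`, `pushLam₂`, `pushLam`, `pushVal`, `pushMap`, `fwdLevel`, `bwdLevel`,
`pushHomeomorph`, `baseSize`, `shadowSet`, `coneSimplex`, `coneHorn`) are the explicit
ingredients of this construction and carry no citation of their own.  What is NOT here: the
iteration over a sequence of elementary collapses (a finite induction over a collapsing order of
a complex, with the images under a simplexwise affine map injective off the collapsed-onto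
subcomplex), and the transport into a topological manifold along a chart
(`Literature.Topology.FourManifolds.Homeomorph.extendAlong`), both left to the engulfing files.

## References

* T. B. Rushing, *Topological Embeddings*, Academic Press (1973), §1.6, Exercise 1.6.12; used in
  the proofs of Thm. 4.2.1 (Stallings' engulfing) and Thm. 4.12.1 (topological engulfing).
  [Rushing1973]
* C. P. Rourke, B. J. Sanderson, *Introduction to Piecewise-Linear Topology*, Springer (1972),
  Ch. 3 (collapsing and regular neighbourhoods). [RourkeSanderson1972]
-/

open Set Function Metric Filter
open scoped Topology

noncomputable section

namespace Literature.Topology.FourManifolds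

/-! ### Complements on the piecewise-linear profiles -/

section Profile

variable {s₁ s₂ s₃ v : ℝ}

/-- A profile with `v ≥ s₂` lies above the identity. [folklore] -/
theorem self_le_plProfile (h₁ : s₁ < s₂) (h₂ : s₂ < s₃) (hv : s₂ ≤ v) (hv₃ : v ≤ s₃) (s : ℝ) :
    s ≤ plProfile s₁ s₂ s₃ v s := by
  rcases le_or_gt s s₁ with hs | hs
  · rw [plProfile_of_le_one hs]
  rcases le_or_gt s s₂ with hs' | hs'
  · rw [plProfile_of_mem_two ⟨hs.le, hs'⟩]
    have hk : 1 ≤ (v - s₁) / (s₂ - s₁) := by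
      rw [le_div_iff₀ (sub_pos.2 h₁)]; linarith
    nlinarith [sub_nonneg.2 hs.le]
  rcases le_or_gt s s₃ with hs'' | hs''
  · rw [plProfile_of_mem_three h₁ ⟨hs'.le, hs''⟩]
    have hk : (s₃ - v) / (s₃ - s₂) ≤ 1 := by
      rw [div_le_iff₀ (sub_pos.2 h₂)]; linarith
    have hk0 : 0 ≤ (s₃ - v) / (s₃ - s₂) := div_nonneg (by linarith) (by linarith)
    have : (s₃ - s₂) * ((s₃ - v) / (s₃ - s₂)) = s₃ - v :=
      mul_div_cancel₀ _ (sub_ne_zero.2 h₂.ne')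
    nlinarith [sub_nonneg.2 hs'.le, sub_nonneg.2 hs'']
  · rw [plProfile_of_three_le h₁ h₂ hs''.le]

/-- A profile with `v ≤ s₂` lies below the identity. [folklore] -/
theorem plProfile_le_self (h₁ : s₁ < s₂) (h₂ : s₂ < s₃) (hv₁ : s₁ ≤ v) (hv : v ≤ s₂) (s : ℝ) :
    plProfile s₁ s₂ s₃ v s ≤ s := by
  rcases le_or_gt s s₁ with hs | hs
  · rw [plProfile_of_le_one hs]
  rcases le_or_gt s s₂ with hs' | hs'
  · rw [plProfile_of_mem_two ⟨hs.le, hs'⟩]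
    have hk : (v - s₁) / (s₂ - s₁) ≤ 1 := by
      rw [div_le_iff₀ (sub_pos.2 h₁)]; linarith
    have hk0 : 0 ≤ (v - s₁) / (s₂ - s₁) := div_nonneg (by linarith) (by linarith)
    nlinarith [sub_nonneg.2 hs.le]
  rcases le_or_gt s s₃ with hs'' | hs''
  · rw [plProfile_of_mem_three h₁ ⟨hs'.le, hs''⟩]
    have hk : 1 ≤ (s₃ - v) / (s₃ - s₂) := by
      rw [le_div_iff₀ (sub_pos.2 h₂)]; linarith
    have : (s₃ - s₂) * ((s₃ - v) / (s₃ - s₂)) = s₃ - v :=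
      mul_div_cancel₀ _ (sub_ne_zero.2 h₂.ne')
    nlinarith [sub_nonneg.2 hs'.le, sub_nonneg.2 hs'']
  · rw [plProfile_of_three_le h₁ h₂ hs''.le]

/-- A nondegenerate profile moves `(s₁, ∞)` into itself. [folklore] -/
theorem lt_plProfile (h₁ : s₁ < s₂) (h₂ : s₂ < s₃) (hv₁ : s₁ < v) (hv₃ : v < s₃) {s : ℝ}
    (hs : s₁ < s) : s₁ < plProfile s₁ s₂ s₃ v s := by
  have h := strictMono_plProfile h₁ h₂ hv₁ hv₃ hs
  rwa [plProfile_of_le_one le_rfl] at h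

/-- **The profiles with the roles of `s₂` and `v` exchanged are mutually inverse.** [folklore] -/
theorem plProfile_plProfile_swap (h₁ : s₁ < s₂) (h₂ : s₂ < s₃) (hv₁ : s₁ < v) (hv₃ : v < s₃)
    (s : ℝ) : plProfile s₁ v s₃ s₂ (plProfile s₁ s₂ s₃ v s) = s := by
  rcases le_or_gt s s₁ with hs | hs
  · rw [plProfile_of_le_one hs, plProfile_of_le_one hs]
  have hn₁ : s₂ - s₁ ≠ 0 := sub_ne_zero.2 h₁.ne'
  have hn₂ : v - s₁ ≠ 0 := sub_ne_zero.2 hv₁.ne'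
  have hn₃ : s₃ - s₂ ≠ 0 := sub_ne_zero.2 h₂.ne'
  have hn₄ : s₃ - v ≠ 0 := sub_ne_zero.2 hv₃.ne'
  rcases le_or_gt s s₂ with hs' | hs'
  · rw [plProfile_of_mem_two ⟨hs.le, hs'⟩]
    have hk0 : 0 ≤ (v - s₁) / (s₂ - s₁) := div_nonneg (by linarith) (by linarith)
    have hy₁ : s₁ ≤ s₁ + (s - s₁) * ((v - s₁) / (s₂ - s₁)) := by nlinarith [sub_nonneg.2 hs.le]
    have hy₂ : s₁ + (s - s₁) * ((v - s₁) / (s₂ - s₁)) ≤ v := by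
      have : (s₂ - s₁) * ((v - s₁) / (s₂ - s₁)) = v - s₁ := mul_div_cancel₀ _ hn₁
      nlinarith [sub_nonneg.2 hs']
    rw [plProfile_of_mem_two ⟨hy₁, hy₂⟩]
    field_simp
    ring
  rcases le_or_gt s s₃ with hs'' | hs''
  · rw [plProfile_of_mem_three h₁ ⟨hs'.le, hs''⟩]
    have hk0 : 0 ≤ (s₃ - v) / (s₃ - s₂) := div_nonneg (by linarith) (by linarith)
    have hy₁ : v ≤ v + (s - s₂) * ((s₃ - v) / (s₃ - s₂)) := by nlinarith [sub_nonneg.2 hs'.le]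
    have hy₂ : v + (s - s₂) * ((s₃ - v) / (s₃ - s₂)) ≤ s₃ := by
      have : (s₃ - s₂) * ((s₃ - v) / (s₃ - s₂)) = s₃ - v := mul_div_cancel₀ _ hn₃
      nlinarith [sub_nonneg.2 hs'']
    rw [plProfile_of_mem_three hv₁ ⟨hy₁, hy₂⟩]
    field_simp
    ring
  · rw [plProfile_of_three_le h₁ h₂ hs''.le, plProfile_of_three_le hv₁ hv₃ hs''.le]

/-- The profile with value `s₂` at `s₂` is the identity. [folklore] -/
theorem plProfile_value_eq_self (h₁ : s₁ < s₂) (h₂ : s₂ < s₃) (s : ℝ) :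
    plProfile s₁ s₂ s₃ s₂ s = s :=
  le_antisymm (plProfile_le_self h₁ h₂ h₁.le le_rfl s) (self_le_plProfile h₁ h₂ le_rfl h₂.le s)

/-- **Joint continuity in the value and the variable.** [folklore] -/
theorem continuous_plProfile_uncurry (h₁ : s₁ < s₂) (h₂ : s₂ < s₃) :
    Continuous fun q : ℝ × ℝ => plProfile s₁ s₂ s₃ q.1 q.2 := by
  unfold plProfile
  refine Continuous.if_le continuous_snd ?_ continuous_snd continuous_const (fun q hq => ?_)
  · refine Continuous.if_le (by fun_prop) ?_ continuous_snd continuous_const (fun q hq => ?_)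
    · refine Continuous.if_le (by fun_prop) continuous_snd continuous_snd continuous_const
        (fun q hq => ?_)
      rw [hq, mul_div_cancel₀ _ (sub_ne_zero.2 h₂.ne')]
      ring
    · rw [hq, if_pos h₂.le, mul_div_cancel₀ _ (sub_ne_zero.2 h₁.ne')]
      ring
  · simp [hq, h₁.le]

/-- **Joint continuity in the middle breakpoint and the variable**, the breakpoint being clamped
to a compact subinterval `[p₁, p₂] ⊆ (s₁, s₃)`. [folklore] -/
theorem continuous_plProfile_clamp_uncurry {p₁ p₂ : ℝ} (h₁ : s₁ < p₁) (h₁₂ : p₁ ≤ p₂)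
    (h₂ : p₂ < s₃) :
    Continuous fun q : ℝ × ℝ => plProfile s₁ (max p₁ (min p₂ q.1)) s₃ v q.2 := by
  have hc : Continuous fun q : ℝ × ℝ => max p₁ (min p₂ q.1) := by fun_prop
  have hlo : ∀ q : ℝ × ℝ, p₁ ≤ max p₁ (min p₂ q.1) := fun q => le_max_left _ _
  have hhi : ∀ q : ℝ × ℝ, max p₁ (min p₂ q.1) ≤ p₂ := fun q =>
    max_le h₁₂ (min_le_left _ _)
  have hd₁ : ∀ q : ℝ × ℝ, max p₁ (min p₂ q.1) - s₁ ≠ 0 := fun q => by linarith [hlo q]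
  have hd₂ : ∀ q : ℝ × ℝ, s₃ - max p₁ (min p₂ q.1) ≠ 0 := fun q => by linarith [hhi q]
  unfold plProfile
  refine Continuous.if_le continuous_snd ?_ continuous_snd continuous_const (fun q hq => ?_)
  · refine Continuous.if_le ?_ ?_ continuous_snd hc (fun q hq => ?_)
    · exact continuous_const.add ((continuous_snd.sub continuous_const).mul
        ((continuous_const.sub continuous_const).div (hc.sub continuous_const) hd₁))
    · refine Continuous.if_le ?_ continuous_snd continuous_snd continuous_const (fun q hq => ?_)
      · exact continuous_const.add ((continuous_snd.sub hc).mul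
          ((continuous_const.sub continuous_const).div (continuous_const.sub hc) hd₂))
      · rw [hq, mul_div_cancel₀ _ (hd₂ q)]
        ring
    · rw [hq, mul_div_cancel₀ _ (hd₁ q)]
      have : max p₁ (min p₂ q.1) ≤ s₃ := (hhi q).trans h₂.le
      rw [if_pos this]
      ring
  · have hle : q.2 ≤ max p₁ (min p₂ q.1) := by rw [hq]; linarith [hlo q]
    show q.2 = if q.2 ≤ max p₁ (min p₂ q.1) then _ else _
    rw [if_pos hle, hq]
    ring

end Profile

namespace SimplexStretch

/-! ### Cone coordinates with respect to an affine basis -/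

section Cone

variable {E : Type*} [NormedAddCommGroup E] [NormedSpace ℝ E]
variable {ι : Type*} [Fintype ι] [DecidableEq ι] (β : AffineBasis ι ℝ E) (i₀ : ι) (IB : Finset ι)

/-- Splitting a sum over all indices into the apex, the base and the rest. [folklore] -/
theorem sum_univ_eq_apex_base_rest {M : Type*} [AddCommMonoid M] {i₀ : ι} {IB : Finset ι}
    (hi₀ : i₀ ∉ IB) (f : ι → M) :
    ∑ i, f i = f i₀ + ∑ i ∈ IB, f i + ∑ i ∈ Finset.univ \ insert i₀ IB, f i := by
  rw [← Finset.sum_sdiff (Finset.subset_univ (insert i₀ IB)), Finset.sum_insert hi₀]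
  abel

/-- The **level** of a point: the sum of its barycentric coordinates at the base vertices
`IB` (`0` at the apex and on the complementary face, `1` on the affine span of the base).
[folklore] -/
def coneLev (x : E) : ℝ := ∑ i ∈ IB, β.coord i x

/-- The **cone vector** of a point: the part of `x - β i₀` along the base directions.
[folklore] -/
def coneW (x : E) : E := ∑ i ∈ IB, β.coord i x • (β i - β i₀)

/-- The **normal part** of a point: the part of `x - β i₀` along the remaining directions.
[folklore] -/
def coneZ (x : E) : E := ∑ i ∈ Finset.univ \ insert i₀ IB, β.coord i x • (β i - β i₀)

/-- The **depth** of a point: its least barycentric coordinate at a base vertex (nonempty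
base). [folklore] -/
def coneMin (hIB : IB.Nonempty) (x : E) : ℝ := IB.inf' hIB fun i => β.coord i x

variable {β i₀ IB}

omit [Fintype ι] [DecidableEq ι] in
/-- The level is continuous. [folklore] -/
theorem continuous_coneLev [FiniteDimensional ℝ E] : Continuous (coneLev β IB) :=
  continuous_finsetSum _ fun i _ => continuous_barycentric_coord β i

omit [Fintype ι] [DecidableEq ι] in
/-- The cone vector is continuous. [folklore] -/
theorem continuous_coneW [FiniteDimensional ℝ E] : Continuous (coneW β i₀ IB) :=
  continuous_finsetSum _ fun i _ => (continuous_barycentric_coord β i).smul continuous_const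

/-- The normal part is continuous. [folklore] -/
theorem continuous_coneZ [FiniteDimensional ℝ E] : Continuous (coneZ β i₀ IB) :=
  continuous_finsetSum _ fun i _ => (continuous_barycentric_coord β i).smul continuous_const

omit [Fintype ι] [DecidableEq ι] in
/-- The depth is continuous. [folklore] -/
theorem continuous_coneMin [FiniteDimensional ℝ E] (hIB : IB.Nonempty) :
    Continuous (coneMin β IB hIB) :=
  Continuous.finset_inf'_apply hIB fun i _ => continuous_barycentric_coord β i

omit [Fintype ι] [DecidableEq ι] in
/-- The cone vector in terms of the base part of the barycentric expansion. [folklore] -/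
theorem coneW_eq (x : E) :
    coneW β i₀ IB x = ∑ i ∈ IB, β.coord i x • β i - coneLev β IB x • β i₀ := by
  simp only [coneW, coneLev, smul_sub, Finset.sum_sub_distrib, Finset.sum_smul]

/-- **Cone decomposition**: `x = β i₀ + coneW x + coneZ x` (for `i₀ ∉ IB`). [folklore] -/
theorem cone_decomp (hi₀ : i₀ ∉ IB) (x : E) : x = β i₀ + coneW β i₀ IB x + coneZ β i₀ IB x := by
  have hsum : ∑ i, β.coord i x • (β i - β i₀) = x - β i₀ := by
    simp_rw [smul_sub]
    rw [Finset.sum_sub_distrib, β.linear_combination_coord_eq_self, ← Finset.sum_smul,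
      β.sum_coord_apply_eq_one, one_smul]
  rw [sum_univ_eq_apex_base_rest hi₀, sub_self, smul_zero, zero_add] at hsum
  have : coneW β i₀ IB x + coneZ β i₀ IB x = x - β i₀ := hsum
  rw [add_assoc, this, add_sub_cancel]

/-- **Coordinates of a pushed point.** Moving `x` along its cone vector, to
`x' = x + (r - 1) • coneW x`, multiplies the base coordinates by `r`, keeps the complementary
coordinates, and adjusts the apex coordinate. [folklore] -/
theorem coord_add_smul_coneW (hi₀ : i₀ ∉ IB) (x : E) (r : ℝ) (i : ι) :
    β.coord i (x + (r - 1) • coneW β i₀ IB x) =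
      if i ∈ IB then r * β.coord i x
      else if i = i₀ then β.coord i₀ x - (r - 1) * coneLev β IB x else β.coord i x := by
  -- the new weights
  let w' : ι → ℝ := fun i => if i ∈ IB then r * β.coord i x
    else if i = i₀ then β.coord i₀ x - (r - 1) * coneLev β IB x else β.coord i x
  have hIC : ∀ i ∈ Finset.univ \ insert i₀ IB, w' i = β.coord i x := fun i hi => by
    have h := (Finset.mem_sdiff.1 hi).2
    rw [Finset.mem_insert, not_or] at h
    simp only [w', if_neg h.2, if_neg h.1]
  have hIB' : ∀ i ∈ IB, w' i = r * β.coord i x := fun i hi => by simp only [w', if_pos hi]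
  have hi₀' : w' i₀ = β.coord i₀ x - (r - 1) * coneLev β IB x := by
    simp only [w', if_neg hi₀, if_true]
  -- abbreviations for the three blocks of `x`
  set S₁ : E := ∑ i ∈ IB, β.coord i x • β i with hS₁
  set S₂ : E := ∑ i ∈ Finset.univ \ insert i₀ IB, β.coord i x • β i with hS₂
  have hx : x = β.coord i₀ x • β i₀ + S₁ + S₂ := by
    have h := β.linear_combination_coord_eq_self x
    rw [sum_univ_eq_apex_base_rest hi₀] at h
    exact h.symm
  have hlev1 : ∑ i, w' i = 1 := by
    rw [sum_univ_eq_apex_base_rest hi₀, hi₀', Finset.sum_congr rfl hIB',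
      Finset.sum_congr rfl hIC, ← Finset.mul_sum]
    have h1 := β.sum_coord_apply_eq_one x
    rw [sum_univ_eq_apex_base_rest hi₀] at h1
    rw [coneLev]
    linarith
  have hcomb : ∑ i, w' i • β i = x + (r - 1) • coneW β i₀ IB x := by
    have hA : ∑ i ∈ IB, w' i • β i = r • S₁ := by
      rw [hS₁, Finset.smul_sum]
      exact Finset.sum_congr rfl fun i hi => by rw [hIB' i hi, mul_smul]
    have hB : ∑ i ∈ Finset.univ \ insert i₀ IB, w' i • β i = S₂ :=
      Finset.sum_congr rfl fun i hi => by rw [hIC i hi]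
    rw [sum_univ_eq_apex_base_rest hi₀, hi₀', hA, hB, coneW_eq, ← hS₁]
    set L := coneLev β IB x with hL
    set c₀ := β.coord i₀ x with hc₀
    rw [show x + (r - 1) • (S₁ - L • β i₀) = (c₀ • β i₀ + S₁ + S₂) + (r - 1) • (S₁ - L • β i₀)
      from by rw [← hx]]
    module
  have hx' : x + (r - 1) • coneW β i₀ IB x = Finset.univ.affineCombination ℝ β w' := by
    rw [Finset.affineCombination_eq_linear_combination _ _ _ hlev1, hcomb]
  rw [hx', β.coord_apply_combination_of_mem (Finset.mem_univ i) hlev1]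

/-- The level of a pushed point. [folklore] -/
theorem coneLev_add_smul_coneW (hi₀ : i₀ ∉ IB) (x : E) (r : ℝ) :
    coneLev β IB (x + (r - 1) • coneW β i₀ IB x) = r * coneLev β IB x := by
  show ∑ i ∈ IB, β.coord i (x + (r - 1) • coneW β i₀ IB x) = r * ∑ i ∈ IB, β.coord i x
  rw [Finset.mul_sum]
  exact Finset.sum_congr rfl fun i hi => by rw [coord_add_smul_coneW hi₀, if_pos hi]

/-- The cone vector of a pushed point. [folklore] -/
theorem coneW_add_smul_coneW (hi₀ : i₀ ∉ IB) (x : E) (r : ℝ) :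
    coneW β i₀ IB (x + (r - 1) • coneW β i₀ IB x) = r • coneW β i₀ IB x := by
  show ∑ i ∈ IB, β.coord i (x + (r - 1) • coneW β i₀ IB x) • (β i - β i₀) =
    r • ∑ i ∈ IB, β.coord i x • (β i - β i₀)
  rw [Finset.smul_sum]
  exact Finset.sum_congr rfl fun i hi => by rw [coord_add_smul_coneW hi₀, if_pos hi, mul_smul]

/-- The normal part of a pushed point. [folklore] -/
theorem coneZ_add_smul_coneW (hi₀ : i₀ ∉ IB) (x : E) (r : ℝ) :
    coneZ β i₀ IB (x + (r - 1) • coneW β i₀ IB x) = coneZ β i₀ IB x := by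
  show ∑ i ∈ Finset.univ \ insert i₀ IB, β.coord i (x + (r - 1) • coneW β i₀ IB x) • (β i - β i₀)
    = ∑ i ∈ Finset.univ \ insert i₀ IB, β.coord i x • (β i - β i₀)
  refine Finset.sum_congr rfl fun i hi => ?_
  have h := (Finset.mem_sdiff.1 hi).2
  rw [Finset.mem_insert, not_or] at h
  rw [coord_add_smul_coneW hi₀, if_neg h.2, if_neg h.1]

/-- The depth of a pushed point (`r ≥ 0`). [folklore] -/
theorem coneMin_add_smul_coneW (hi₀ : i₀ ∉ IB) (hIB : IB.Nonempty) (x : E) {r : ℝ} (hr : 0 ≤ r) :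
    coneMin β IB hIB (x + (r - 1) • coneW β i₀ IB x) = r * coneMin β IB hIB x := by
  show (IB.inf' hIB fun i => β.coord i (x + (r - 1) • coneW β i₀ IB x))
    = r * IB.inf' hIB fun i => β.coord i x
  rw [Finset.apply_inf'_eq_inf'_comp hIB (fun t : ℝ => r * t) (fun a b => mul_min_of_nonneg a b hr)]
  exact Finset.inf'_congr hIB rfl fun i hi => by
    simp only [Function.comp_apply, coord_add_smul_coneW hi₀, if_pos hi]

/-- Undoing a push: pushing by `r` and then by `r'` with `r' r = 1` returns to `x`.
[folklore] -/
theorem add_smul_coneW_add_smul_coneW (hi₀ : i₀ ∉ IB) (x : E) {r r' : ℝ} (hrr' : r' * r = 1) :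
    (x + (r - 1) • coneW β i₀ IB x) + (r' - 1) • coneW β i₀ IB (x + (r - 1) • coneW β i₀ IB x)
      = x := by
  rw [coneW_add_smul_coneW hi₀, smul_smul, add_assoc, ← add_smul]
  have : r - 1 + (r' - 1) * r = 0 := by linear_combination hrr'
  rw [this, zero_smul, add_zero]

end Cone

/-! ### The push along the cone lines -/

section Push

variable {E : Type*} [NormedAddCommGroup E] [NormedSpace ℝ E]
variable {ι : Type*} [Fintype ι] [DecidableEq ι]

/-- Numerical parameters of a push: the fixed lower level `s₁ > 0` (the push acts on levels in
`(s₁, s₃)`, `s₂ = 2 s₁` being the level carried to `vf` by the full push, `s₃ = vf + mg`), the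
depth cutoff `θ` and the normal cutoff `ζ`. [folklore] -/
structure PushData where
  /-- lower fixed level -/
  s₁ : ℝ
  /-- value of the full push at the level `2 s₁` -/
  vf : ℝ
  /-- margin above `vf` -/
  mg : ℝ
  /-- depth cutoff -/
  θ : ℝ
  /-- normal cutoff -/
  ζ : ℝ
  hs₁ : 0 < s₁
  hvf : 2 * s₁ < vf
  hmg : 0 < mg
  hθ : 0 < θ
  hζ : 0 < ζ

namespace PushData

variable (P : PushData)

/-- The level carried to `vf` by the full push. [folklore] -/
def s₂ : ℝ := 2 * P.s₁

/-- The upper fixed level. [folklore] -/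
def s₃ : ℝ := P.vf + P.mg

/-- Auxiliary (`s₁_lt_s₂`). [folklore] -/
theorem s₁_lt_s₂ : P.s₁ < P.s₂ := by rw [s₂]; linarith [P.hs₁]

/-- Auxiliary (`s₂_lt_vf`). [folklore] -/
theorem s₂_lt_vf : P.s₂ < P.vf := P.hvf

/-- Auxiliary (`vf_lt_s₃`). [folklore] -/
theorem vf_lt_s₃ : P.vf < P.s₃ := by rw [s₃]; linarith [P.hmg]

/-- Auxiliary (`s₂_lt_s₃`). [folklore] -/
theorem s₂_lt_s₃ : P.s₂ < P.s₃ := P.s₂_lt_vf.trans P.vf_lt_s₃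

/-- Auxiliary (`s₁_lt_vf`). [folklore] -/
theorem s₁_lt_vf : P.s₁ < P.vf := P.s₁_lt_s₂.trans P.s₂_lt_vf

end PushData

variable (β : AffineBasis ι ℝ E) (i₀ : ι) (IB : Finset ι) (hIB : IB.Nonempty) (P : PushData)

/-- The clamped level `max (coneLev x) s₁ ≥ s₁ > 0`. [folklore] -/
def pushLvl (x : E) : ℝ := max (coneLev β IB x) P.s₁

/-- The depth cutoff `λ₁ ∈ [0, 1]`: `0` where the direction has depth `≤ θ`, `1` where it has
depth `≥ 2θ`. [folklore] -/
def pushLam₁ (x : E) : ℝ :=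
  max 0 (min 1 ((coneMin β IB hIB x / pushLvl β IB P x - P.θ) / P.θ))

/-- The normal cutoff `λ₂ ∈ [0, 1]`: `1` where `‖coneZ x‖ ≤ ζ`, `0` where `‖coneZ x‖ ≥ 2ζ`.
[folklore] -/
def pushLam₂ (x : E) : ℝ := max 0 (min 1 ((2 * P.ζ - ‖coneZ β i₀ IB x‖) / P.ζ))

/-- The strength `λ = λ₁ λ₂ ∈ [0, 1]` of the push at `x`. [folklore] -/
def pushLam (x : E) : ℝ := pushLam₁ β IB hIB P x * pushLam₂ β i₀ IB P x

/-- The value `v_λ = (1 - λ) s₂ + λ vf ∈ [s₂, vf]` of the profile at `s₂`. [folklore] -/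
def pushVal (x : E) : ℝ := (1 - pushLam β i₀ IB hIB P x) * P.s₂ + pushLam β i₀ IB hIB P x * P.vf

/-- The push determined by a *level reassignment* `Φ v L` (the new level of a point of level
`L` when the profile value is `v`): `x ↦ x + (Φ/L - 1) • coneW x`. [folklore] -/
def pushMap (Φ : ℝ → ℝ → ℝ) (x : E) : E :=
  x + (Φ (pushVal β i₀ IB hIB P x) (pushLvl β IB P x) / pushLvl β IB P x - 1) • coneW β i₀ IB x

/-- The forward level reassignment: the profile through `(s₂, v)`. [folklore] -/
def fwdLevel (v L : ℝ) : ℝ := plProfile P.s₁ P.s₂ P.s₃ v L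

/-- The backward level reassignment: the inverse profile through `(v, s₂)`. [folklore] -/
def bwdLevel (v L : ℝ) : ℝ := plProfile P.s₁ v P.s₃ P.s₂ L

variable {β i₀ IB hIB P}

omit [Fintype ι] [DecidableEq ι] in
/-- Auxiliary (`s₁_le_pushLvl`). [folklore] -/
theorem s₁_le_pushLvl (x : E) : P.s₁ ≤ pushLvl β IB P x := le_max_right _ _

omit [Fintype ι] [DecidableEq ι] in
/-- Auxiliary (`pushLvl_pos`). [folklore] -/
theorem pushLvl_pos (x : E) : 0 < pushLvl β IB P x := P.hs₁.trans_le (s₁_le_pushLvl x)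

omit [Fintype ι] [DecidableEq ι] in
/-- Auxiliary (`pushLvl_eq_of_lt`). [folklore] -/
theorem pushLvl_eq_of_lt {x : E} (h : P.s₁ < coneLev β IB x) : pushLvl β IB P x = coneLev β IB x :=
  max_eq_left h.le

omit [Fintype ι] [DecidableEq ι] in
/-- Auxiliary (`pushLvl_eq_of_le`). [folklore] -/
theorem pushLvl_eq_of_le {x : E} (h : coneLev β IB x ≤ P.s₁) : pushLvl β IB P x = P.s₁ :=
  max_eq_right h

omit [Fintype ι] [DecidableEq ι] in
/-- Auxiliary (`pushLam₁_mem`). [folklore] -/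
theorem pushLam₁_mem (x : E) : pushLam₁ β IB hIB P x ∈ Icc (0 : ℝ) 1 :=
  ⟨le_max_left _ _, max_le zero_le_one (min_le_left _ _)⟩

/-- Auxiliary (`pushLam₂_mem`). [folklore] -/
theorem pushLam₂_mem (x : E) : pushLam₂ β i₀ IB P x ∈ Icc (0 : ℝ) 1 :=
  ⟨le_max_left _ _, max_le zero_le_one (min_le_left _ _)⟩

/-- Auxiliary (`pushLam_mem`). [folklore] -/
theorem pushLam_mem (x : E) : pushLam β i₀ IB hIB P x ∈ Icc (0 : ℝ) 1 :=
  ⟨mul_nonneg (pushLam₁_mem x).1 (pushLam₂_mem x).1,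
    mul_le_one₀ (pushLam₁_mem x).2 (pushLam₂_mem x).1 (pushLam₂_mem x).2⟩

/-- Auxiliary (`pushVal_mem`). [folklore] -/
theorem pushVal_mem (x : E) : pushVal β i₀ IB hIB P x ∈ Icc P.s₂ P.vf := by
  obtain ⟨h0, h1⟩ := pushLam_mem (β := β) (i₀ := i₀) (IB := IB) (hIB := hIB) (P := P) x
  have h := P.s₂_lt_vf
  constructor
  · rw [pushVal]; nlinarith
  · rw [pushVal]; nlinarith

/-- Auxiliary (`s₁_lt_pushVal`). [folklore] -/
theorem s₁_lt_pushVal (x : E) : P.s₁ < pushVal β i₀ IB hIB P x :=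
  P.s₁_lt_s₂.trans_le (pushVal_mem x).1

/-- Auxiliary (`pushVal_lt_s₃`). [folklore] -/
theorem pushVal_lt_s₃ (x : E) : pushVal β i₀ IB hIB P x < P.s₃ :=
  (pushVal_mem x).2.trans_lt P.vf_lt_s₃

/-! #### Invariance of the strength under pushes -/

/-- The level of a push with ratio `r`. [folklore] -/
theorem coneLev_push (hi₀ : i₀ ∉ IB) (x : E) (r : ℝ) :
    coneLev β IB (x + (r - 1) • coneW β i₀ IB x) = r * coneLev β IB x :=
  coneLev_add_smul_coneW hi₀ x r

/-- The strength is unchanged by a push with positive ratio of a point of level `> s₁` whose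
new level is `> s₁`. [folklore] -/
theorem pushLam_push (hi₀ : i₀ ∉ IB) {x : E} {r : ℝ} (hr : 0 < r) (hx : P.s₁ < coneLev β IB x)
    (hx' : P.s₁ < r * coneLev β IB x) :
    pushLam β i₀ IB hIB P (x + (r - 1) • coneW β i₀ IB x) = pushLam β i₀ IB hIB P x := by
  have hL : pushLvl β IB P x = coneLev β IB x := pushLvl_eq_of_lt hx
  have hL' : pushLvl β IB P (x + (r - 1) • coneW β i₀ IB x) = r * coneLev β IB x := by
    rw [pushLvl, coneLev_push hi₀, max_eq_left hx'.le]
  have h1 : pushLam₁ β IB hIB P (x + (r - 1) • coneW β i₀ IB x) = pushLam₁ β IB hIB P x := by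
    rw [pushLam₁, pushLam₁, hL', hL, coneMin_add_smul_coneW hi₀ hIB x hr.le,
      mul_div_mul_left _ _ hr.ne']
  have h2 : pushLam₂ β i₀ IB P (x + (r - 1) • coneW β i₀ IB x) = pushLam₂ β i₀ IB P x := by
    rw [pushLam₂, pushLam₂, coneZ_add_smul_coneW hi₀]
  rw [pushLam, pushLam, h1, h2]

/-- **Mutually inverse pushes.** If the level reassignments `Φ₁, Φ₂` fix the level `s₁`, move
`(s₁, ∞)` into itself, and satisfy `Φ₂ v (Φ₁ v L) = L` for `L > s₁` (for the admissible
values `v`), then the push by `Φ₂` undoes the push by `Φ₁`. [folklore] -/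
theorem pushMap_pushMap (hi₀ : i₀ ∉ IB) {Φ₁ Φ₂ : ℝ → ℝ → ℝ}
    (hfix : ∀ v, Φ₁ v P.s₁ = P.s₁) (hfix' : ∀ v, Φ₂ v P.s₁ = P.s₁)
    (hgt : ∀ v L, P.s₂ ≤ v → v ≤ P.vf → P.s₁ < L → P.s₁ < Φ₁ v L)
    (hinv : ∀ v L, P.s₂ ≤ v → v ≤ P.vf → P.s₁ < L → Φ₂ v (Φ₁ v L) = L) (x : E) :
    pushMap β i₀ IB hIB P Φ₂ (pushMap β i₀ IB hIB P Φ₁ x) = x := by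
  rcases le_or_gt (coneLev β IB x) P.s₁ with hx | hx
  · -- below the fixed level nothing moves
    have h1 : pushMap β i₀ IB hIB P Φ₁ x = x := by
      rw [pushMap, pushLvl_eq_of_le hx, hfix, div_self P.hs₁.ne', sub_self, zero_smul, add_zero]
    rw [h1, pushMap, pushLvl_eq_of_le hx, hfix', div_self P.hs₁.ne', sub_self, zero_smul,
      add_zero]
  · set L := coneLev β IB x with hLdef
    set v := pushVal β i₀ IB hIB P x with hvdef
    have hL : pushLvl β IB P x = L := pushLvl_eq_of_lt hx
    have hLpos : 0 < L := P.hs₁.trans hx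
    have hv := pushVal_mem (β := β) (i₀ := i₀) (IB := IB) (hIB := hIB) (P := P) x
    set r : ℝ := Φ₁ v L / L with hr
    have hΦ₁ : P.s₁ < Φ₁ v L := hgt v L hv.1 hv.2 hx
    have hrpos : 0 < r := div_pos (P.hs₁.trans hΦ₁) hLpos
    have hx1 : pushMap β i₀ IB hIB P Φ₁ x = x + (r - 1) • coneW β i₀ IB x := by
      rw [pushMap, hL]
    have hrL : r * L = Φ₁ v L := div_mul_cancel₀ _ hLpos.ne'
    have hx' : P.s₁ < r * coneLev β IB x := by rw [← hLdef, hrL]; exact hΦ₁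
    -- the data of the pushed point
    have hL' : pushLvl β IB P (x + (r - 1) • coneW β i₀ IB x) = Φ₁ v L := by
      rw [pushLvl, coneLev_push hi₀, ← hLdef, hrL, max_eq_left hΦ₁.le]
    have hv' : pushVal β i₀ IB hIB P (x + (r - 1) • coneW β i₀ IB x) = v := by
      rw [pushVal, pushLam_push hi₀ hrpos hx hx', hvdef, pushVal]
    rw [hx1, pushMap, hL', hv', hinv v L hv.1 hv.2 hx]
    refine add_smul_coneW_add_smul_coneW hi₀ x ?_
    rw [hr, div_mul_div_comm, mul_comm L (Φ₁ v L)]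
    exact div_self (mul_ne_zero (P.hs₁.trans hΦ₁).ne' hLpos.ne')

/-- The forward and backward reassignments are mutually inverse pushes. [folklore] -/
theorem pushMap_bwd_fwd (hi₀ : i₀ ∉ IB) (x : E) :
    pushMap β i₀ IB hIB P (bwdLevel P) (pushMap β i₀ IB hIB P (fwdLevel P) x) = x := by
  refine pushMap_pushMap hi₀ (fun v => ?_) (fun v => ?_) (fun v L hv₁ hv₂ hL => ?_)
    (fun v L hv₁ hv₂ hL => ?_) x
  · exact plProfile_of_le_one le_rfl
  · exact plProfile_of_le_one le_rfl
  · exact lt_plProfile P.s₁_lt_s₂ P.s₂_lt_s₃ (P.s₁_lt_s₂.trans_le hv₁) (hv₂.trans_lt P.vf_lt_s₃) hL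
  · exact plProfile_plProfile_swap P.s₁_lt_s₂ P.s₂_lt_s₃ (P.s₁_lt_s₂.trans_le hv₁)
      (hv₂.trans_lt P.vf_lt_s₃) L

/-- The backward and forward reassignments are mutually inverse pushes. [folklore] -/
theorem pushMap_fwd_bwd (hi₀ : i₀ ∉ IB) (x : E) :
    pushMap β i₀ IB hIB P (fwdLevel P) (pushMap β i₀ IB hIB P (bwdLevel P) x) = x := by
  refine pushMap_pushMap hi₀ (fun v => ?_) (fun v => ?_) (fun v L hv₁ hv₂ hL => ?_)
    (fun v L hv₁ hv₂ hL => ?_) x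
  · exact plProfile_of_le_one le_rfl
  · exact plProfile_of_le_one le_rfl
  · exact lt_plProfile (P.s₁_lt_s₂.trans_le hv₁) (hv₂.trans_lt P.vf_lt_s₃) P.s₁_lt_s₂ P.s₂_lt_s₃ hL
  · exact plProfile_plProfile_swap (P.s₁_lt_s₂.trans_le hv₁) (hv₂.trans_lt P.vf_lt_s₃)
      P.s₁_lt_s₂ P.s₂_lt_s₃ L

/-! #### Continuity -/

variable [FiniteDimensional ℝ E]

omit [Fintype ι] [DecidableEq ι] in
/-- Auxiliary (`continuous_pushLvl`). [folklore] -/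
theorem continuous_pushLvl : Continuous (pushLvl β IB P) :=
  continuous_coneLev.max continuous_const

omit [Fintype ι] [DecidableEq ι] in
/-- Auxiliary (`continuous_pushLam₁`). [folklore] -/
theorem continuous_pushLam₁ : Continuous (pushLam₁ β IB hIB P) := by
  unfold pushLam₁
  refine continuous_const.max (continuous_const.min ?_)
  refine Continuous.div_const (Continuous.sub ?_ continuous_const) _
  exact (continuous_coneMin hIB).div continuous_pushLvl fun x => (pushLvl_pos x).ne'

/-- Auxiliary (`continuous_pushLam₂`). [folklore] -/
theorem continuous_pushLam₂ : Continuous (pushLam₂ β i₀ IB P) := by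
  unfold pushLam₂
  exact continuous_const.max (continuous_const.min
    ((continuous_const.sub continuous_coneZ.norm).div_const _))

/-- Auxiliary (`continuous_pushLam`). [folklore] -/
theorem continuous_pushLam : Continuous (pushLam β i₀ IB hIB P) :=
  continuous_pushLam₁.mul continuous_pushLam₂

/-- Auxiliary (`continuous_pushVal`). [folklore] -/
theorem continuous_pushVal : Continuous (pushVal β i₀ IB hIB P) := by
  unfold pushVal
  exact ((continuous_const.sub continuous_pushLam).mul continuous_const).add
    (continuous_pushLam.mul continuous_const)

/-- A push by a level reassignment which is jointly continuous on the admissible values is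
continuous. [folklore] -/
theorem continuous_pushMap {Φ : ℝ → ℝ → ℝ}
    (hΦ : Continuous fun q : ℝ × ℝ => Φ (max P.s₂ (min P.vf q.1)) q.2) :
    Continuous (pushMap β i₀ IB hIB P Φ) := by
  have hclamp : ∀ x : E, max P.s₂ (min P.vf (pushVal β i₀ IB hIB P x)) = pushVal β i₀ IB hIB P x :=
    fun x => by
      obtain ⟨h1, h2⟩ := pushVal_mem (β := β) (i₀ := i₀) (IB := IB) (hIB := hIB) (P := P) x
      rw [min_eq_right h2, max_eq_right h1]
  have hΦ' : Continuous fun x : E => Φ (pushVal β i₀ IB hIB P x) (pushLvl β IB P x) := by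
    have h := hΦ.comp (continuous_pushVal.prodMk continuous_pushLvl :
      Continuous fun x : E => (pushVal β i₀ IB hIB P x, pushLvl β IB P x))
    refine h.congr fun x => ?_
    simp only [Function.comp_apply, hclamp]
  unfold pushMap
  exact continuous_id.add (((hΦ'.div continuous_pushLvl fun x => (pushLvl_pos x).ne').sub
    continuous_const).smul continuous_coneW)

/-- Auxiliary (`continuous_pushMap_fwd`). [folklore] -/
theorem continuous_pushMap_fwd : Continuous (pushMap β i₀ IB hIB P (fwdLevel P)) :=
  continuous_pushMap ((continuous_plProfile_uncurry P.s₁_lt_s₂ P.s₂_lt_s₃).comp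
    ((continuous_const.max (continuous_const.min continuous_fst)).prodMk continuous_snd))

/-- Auxiliary (`continuous_pushMap_bwd`). [folklore] -/
theorem continuous_pushMap_bwd : Continuous (pushMap β i₀ IB hIB P (bwdLevel P)) :=
  continuous_pushMap (continuous_plProfile_clamp_uncurry P.s₁_lt_s₂ P.s₂_lt_vf.le P.vf_lt_s₃)

/-- **The push homeomorphism** of `E` along the cone lines. [folklore] -/
def pushHomeomorph (hi₀ : i₀ ∉ IB) : E ≃ₜ E where
  toFun := pushMap β i₀ IB hIB P (fwdLevel P)
  invFun := pushMap β i₀ IB hIB P (bwdLevel P)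
  left_inv := pushMap_bwd_fwd hi₀
  right_inv := pushMap_fwd_bwd hi₀
  continuous_toFun := continuous_pushMap_fwd
  continuous_invFun := continuous_pushMap_bwd

end Push

/-! ### Where the push moves points; the shadow set -/

section Moved

variable {E : Type*} [NormedAddCommGroup E] [NormedSpace ℝ E]
variable {ι : Type*} [Fintype ι] [DecidableEq ι]
variable {β : AffineBasis ι ℝ E} {i₀ : ι} {IB : Finset ι} {hIB : IB.Nonempty} {P : PushData}

/-- Below the fixed level a push (by a reassignment fixing `s₁`) does not move. [folklore] -/
theorem pushMap_eq_self_of_coneLev_le {Φ : ℝ → ℝ → ℝ} (hfix : ∀ v, Φ v P.s₁ = P.s₁) {x : E}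
    (hx : coneLev β IB x ≤ P.s₁) : pushMap β i₀ IB hIB P Φ x = x := by
  rw [pushMap, pushLvl_eq_of_le hx, hfix, div_self P.hs₁.ne', sub_self, zero_smul, add_zero]

/-- The forward push does not move points of level `≥ s₃`. [folklore] -/
theorem pushMap_fwd_eq_self_of_s₃_le {x : E} (hx : P.s₃ ≤ coneLev β IB x) :
    pushMap β i₀ IB hIB P (fwdLevel P) x = x := by
  have hlt : P.s₁ < coneLev β IB x := (P.s₁_lt_s₂.trans P.s₂_lt_s₃).trans_le hx
  rw [pushMap, pushLvl_eq_of_lt hlt, fwdLevel, plProfile_of_three_le P.s₁_lt_s₂ P.s₂_lt_s₃ hx,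
    div_self (P.hs₁.trans hlt).ne', sub_self, zero_smul, add_zero]

/-- The forward push does not move points of strength `0`. [folklore] -/
theorem pushMap_fwd_eq_self_of_pushLam_eq_zero {x : E} (hx : pushLam β i₀ IB hIB P x = 0) :
    pushMap β i₀ IB hIB P (fwdLevel P) x = x := by
  have hv : pushVal β i₀ IB hIB P x = P.s₂ := by rw [pushVal, hx]; ring
  rw [pushMap, hv, fwdLevel, plProfile_value_eq_self P.s₁_lt_s₂ P.s₂_lt_s₃,
    div_self (pushLvl_pos x).ne', sub_self, zero_smul, add_zero]

/-- A clamp `max 0 (min 1 t)` is positive only if `t` is. [folklore] -/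
theorem pos_of_clamp_pos {t : ℝ} (h : 0 < max 0 (min 1 t)) : 0 < t := by
  rcases le_or_gt t 0 with ht | ht
  · rw [max_eq_left ((min_le_right _ _).trans ht)] at h
    exact absurd h (lt_irrefl 0)
  · exact ht

/-- **Where the forward push moves points**: only at levels strictly between `s₁` and `s₃`,
at depth `> θ ·` level, and normal part of norm `< 2ζ`. [folklore] -/
theorem moved_fwd {x : E} (hx : pushMap β i₀ IB hIB P (fwdLevel P) x ≠ x) :
    P.s₁ < coneLev β IB x ∧ coneLev β IB x < P.s₃ ∧
      P.θ * coneLev β IB x < coneMin β IB hIB x ∧ ‖coneZ β i₀ IB x‖ < 2 * P.ζ := by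
  have h1 : P.s₁ < coneLev β IB x := by
    by_contra h
    exact hx (pushMap_eq_self_of_coneLev_le (fun v => plProfile_of_le_one le_rfl) (not_lt.1 h))
  have h2 : coneLev β IB x < P.s₃ := by
    by_contra h
    exact hx (pushMap_fwd_eq_self_of_s₃_le (not_lt.1 h))
  have hlam : 0 < pushLam β i₀ IB hIB P x := by
    refine lt_of_le_of_ne (pushLam_mem x).1 fun h => hx ?_
    exact pushMap_fwd_eq_self_of_pushLam_eq_zero h.symm
  have hlam₁ : 0 < pushLam₁ β IB hIB P x := by
    refine lt_of_le_of_ne (pushLam₁_mem x).1 fun h => ?_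
    rw [pushLam, ← h, zero_mul] at hlam
    exact lt_irrefl _ hlam
  have hlam₂ : 0 < pushLam₂ β i₀ IB P x := by
    refine lt_of_le_of_ne (pushLam₂_mem x).1 fun h => ?_
    rw [pushLam, ← h, mul_zero] at hlam
    exact lt_irrefl _ hlam
  have hL : pushLvl β IB P x = coneLev β IB x := pushLvl_eq_of_lt h1
  have hLpos : 0 < coneLev β IB x := P.hs₁.trans h1
  refine ⟨h1, h2, ?_, ?_⟩
  · have h := pos_of_clamp_pos hlam₁
    rw [hL] at h
    have h' : 0 < coneMin β IB hIB x / coneLev β IB x - P.θ := by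
      by_contra hneg
      push Not at hneg
      exact absurd (div_nonpos_of_nonpos_of_nonneg hneg P.hθ.le) (not_le.2 h)
    have h'' : P.θ < coneMin β IB hIB x / coneLev β IB x := by linarith
    rwa [lt_div_iff₀ hLpos] at h''
  · have h := pos_of_clamp_pos hlam₂
    have h' : 0 < 2 * P.ζ - ‖coneZ β i₀ IB x‖ := by
      by_contra hneg
      push Not at hneg
      exact absurd (div_nonpos_of_nonpos_of_nonneg hneg P.hζ.le) (not_le.2 h)
    linarith

/-! #### Barycentric bookkeeping: coordinates, hulls, facets -/

/-- Coordinates of points of the base cone over the apex: `β i₀ + ρ • coneW x`. [folklore] -/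
theorem coord_apex_add_smul_coneW (hi₀ : i₀ ∉ IB) (x : E) (ρ : ℝ) (i : ι) :
    β.coord i (β i₀ + ρ • coneW β i₀ IB x) =
      if i ∈ IB then ρ * β.coord i x else if i = i₀ then 1 - ρ * coneLev β IB x else 0 := by
  let w' : ι → ℝ := fun i =>
    if i ∈ IB then ρ * β.coord i x else if i = i₀ then 1 - ρ * coneLev β IB x else 0
  have hIC : ∀ i ∈ Finset.univ \ insert i₀ IB, w' i = 0 := fun i hi => by
    have h := (Finset.mem_sdiff.1 hi).2
    rw [Finset.mem_insert, not_or] at h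
    simp only [w', if_neg h.2, if_neg h.1]
  have hIB' : ∀ i ∈ IB, w' i = ρ * β.coord i x := fun i hi => by simp only [w', if_pos hi]
  have hi₀' : w' i₀ = 1 - ρ * coneLev β IB x := by simp only [w', if_neg hi₀, if_true]
  have hw1 : ∑ i, w' i = 1 := by
    rw [sum_univ_eq_apex_base_rest hi₀, hi₀', Finset.sum_congr rfl hIB',
      Finset.sum_eq_zero hIC, ← Finset.mul_sum, coneLev]
    ring
  have hcomb : ∑ i, w' i • β i = β i₀ + ρ • coneW β i₀ IB x := by
    have hA : ∑ i ∈ IB, w' i • β i = ρ • ∑ i ∈ IB, β.coord i x • β i := by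
      rw [Finset.smul_sum]
      exact Finset.sum_congr rfl fun i hi => by rw [hIB' i hi, mul_smul]
    have hB : ∑ i ∈ Finset.univ \ insert i₀ IB, w' i • β i = 0 :=
      Finset.sum_eq_zero fun i hi => by rw [hIC i hi, zero_smul]
    rw [sum_univ_eq_apex_base_rest hi₀, hi₀', hA, hB, coneW_eq]
    module
  have hx' : β i₀ + ρ • coneW β i₀ IB x = Finset.univ.affineCombination ℝ β w' := by
    rw [Finset.affineCombination_eq_linear_combination _ _ _ hw1, hcomb]
  rw [hx', β.coord_apply_combination_of_mem (Finset.mem_univ i) hw1]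

omit [DecidableEq ι] in
/-- A point with nonnegative coordinates vanishing off `S` lies in the closed simplex spanned
by the vertices `β(S)`. [folklore] -/
theorem mem_convexHull_image_of_coord (S : Finset ι) {y : E} (h0 : ∀ i, 0 ≤ β.coord i y)
    (hS : ∀ i, i ∉ S → β.coord i y = 0) : y ∈ convexHull ℝ (β '' (S : Set ι)) := by
  have hsum : ∑ i ∈ S, β.coord i y = 1 := by
    rw [← β.sum_coord_apply_eq_one y, ← Finset.sum_subset (Finset.subset_univ S)
      fun i _ hi => hS i hi]
  have hy : y = ∑ i ∈ S, β.coord i y • β i := by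
    conv_lhs => rw [← β.linear_combination_coord_eq_self y]
    rw [← Finset.sum_subset (Finset.subset_univ S) fun i _ hi => by rw [hS i hi, zero_smul]]
  rw [hy, ← Finset.centerMass_eq_of_sum_1 _ _ hsum]
  exact Finset.centerMass_mem_convexHull S (fun i _ => h0 i) (by rw [hsum]; exact one_pos)
    fun i hi => mem_image_of_mem β (Finset.mem_coe.2 hi)

omit [Fintype ι] [DecidableEq ι] in
/-- A coordinate not belonging to `S` vanishes on the closed simplex spanned by `β(S)`.
[folklore] -/
theorem coord_eq_zero_of_mem_convexHull_image {S : Finset ι} {b : ι} (hb : b ∉ S) {y : E}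
    (hy : y ∈ convexHull ℝ (β '' (S : Set ι))) : β.coord b y = 0 := by
  have hconv : Convex ℝ ((β.coord b : E →ᵃ[ℝ] ℝ) ⁻¹' {0}) :=
    (convex_singleton (0 : ℝ)).affine_preimage (β.coord b)
  have hsub : β '' (S : Set ι) ⊆ (β.coord b : E →ᵃ[ℝ] ℝ) ⁻¹' {0} := by
    rintro _ ⟨i, hi, rfl⟩
    have hib : b ≠ i := fun h => hb (h ▸ Finset.mem_coe.1 hi)
    show β.coord b (β i) ∈ ({0} : Set ℝ)
    rw [β.coord_apply_ne hib]
    exact mem_singleton 0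
  exact convexHull_min hsub hconv hy

omit [Fintype ι] in
/-- Coordinates are nonnegative on closed simplices spanned by vertices of the basis.
[folklore] -/
theorem coord_nonneg_of_mem_convexHull_image {S : Finset ι} (i : ι) {y : E}
    (hy : y ∈ convexHull ℝ (β '' (S : Set ι))) : 0 ≤ β.coord i y := by
  have hconv : Convex ℝ ((β.coord i : E →ᵃ[ℝ] ℝ) ⁻¹' Ici 0) :=
    (convex_Ici (0 : ℝ)).affine_preimage (β.coord i)
  have hsub : β '' (S : Set ι) ⊆ (β.coord i : E →ᵃ[ℝ] ℝ) ⁻¹' Ici 0 := by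
    rintro _ ⟨j, -, rfl⟩
    show 0 ≤ β.coord i (β j)
    rw [β.coord_apply i j]
    split_ifs <;> norm_num
  exact convexHull_min hsub hconv hy

omit [DecidableEq ι] in
/-- The level of a point with nonnegative coordinates is at most `1`. [folklore] -/
theorem coneLev_le_one_of_coord_nonneg {y : E} (h0 : ∀ i, 0 ≤ β.coord i y) :
    coneLev β IB y ≤ 1 := by
  rw [coneLev, ← β.sum_coord_apply_eq_one y]
  exact Finset.sum_le_univ_sum_of_nonneg fun i => h0 i

/-- The normal part of a point whose coordinates vanish off `insert i₀ IB` is zero.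
[folklore] -/
theorem coneZ_eq_zero_of_coord {y : E} (hS : ∀ i, i ∉ insert i₀ IB → β.coord i y = 0) :
    coneZ β i₀ IB y = 0 :=
  Finset.sum_eq_zero fun i hi => by rw [hS i (Finset.mem_sdiff.1 hi).2, zero_smul]

/-- The size of the base: `R₀ = ∑_{i ∈ IB} ‖β i - β i₀‖`. [folklore] -/
def baseSize (β : AffineBasis ι ℝ E) (i₀ : ι) (IB : Finset ι) : ℝ := ∑ i ∈ IB, ‖β i - β i₀‖

omit [Fintype ι] [DecidableEq ι] in
/-- Auxiliary (`baseSize_nonneg`). [folklore] -/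
theorem baseSize_nonneg : 0 ≤ baseSize β i₀ IB := Finset.sum_nonneg fun _ _ => norm_nonneg _

omit [Fintype ι] [DecidableEq ι] in
/-- Auxiliary (`norm_sub_apex_le_baseSize`). [folklore] -/
theorem norm_sub_apex_le_baseSize {b : ι} (hb : b ∈ IB) : ‖β b - β i₀‖ ≤ baseSize β i₀ IB :=
  Finset.single_le_sum (f := fun i => ‖β i - β i₀‖) (fun _ _ => norm_nonneg _) hb

omit [Fintype ι] [DecidableEq ι] in
/-- **Size of the cone vector**: `‖coneW y‖ ≤ coneLev y · R₀` when the base coordinates are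
nonnegative. [folklore] -/
theorem norm_coneW_le {y : E} (h0 : ∀ i ∈ IB, 0 ≤ β.coord i y) :
    ‖coneW β i₀ IB y‖ ≤ coneLev β IB y * baseSize β i₀ IB := by
  have hle : ∀ i ∈ IB, β.coord i y ≤ coneLev β IB y := fun i hi =>
    Finset.single_le_sum (f := fun j => β.coord j y) h0 hi
  calc ‖coneW β i₀ IB y‖ ≤ ∑ i ∈ IB, ‖β.coord i y • (β i - β i₀)‖ := norm_sum_le _ _
    _ = ∑ i ∈ IB, β.coord i y * ‖β i - β i₀‖ := Finset.sum_congr rfl fun i hi => by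
        rw [norm_smul, Real.norm_of_nonneg (h0 i hi)]
    _ ≤ ∑ i ∈ IB, coneLev β IB y * ‖β i - β i₀‖ := Finset.sum_le_sum fun i hi =>
        mul_le_mul_of_nonneg_right (hle i hi) (norm_nonneg _)
    _ = coneLev β IB y * baseSize β i₀ IB := by rw [baseSize, Finset.mul_sum]

/-! #### The shadow set -/

variable (β i₀ IB hIB) in
/-- The **shadow set** of depth `c₀`: the points of the closed simplex (coordinates vanishing off
`insert i₀ IB`) of level `≤ 1` and depth `≥ c₀` — a compact subset of the simplex missing
every facet through the apex when `c₀ > 0`. [folklore] -/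
def shadowSet (c₀ : ℝ) : Set E :=
  {y | (∀ i, i ∉ insert i₀ IB → β.coord i y = 0) ∧ coneLev β IB y ≤ 1 ∧ c₀ ≤ coneMin β IB hIB y}

omit [Fintype ι] in
/-- Base coordinates of points of the shadow set are at least `c₀`. [folklore] -/
theorem le_coord_of_mem_shadowSet {c₀ : ℝ} {y : E} (hy : y ∈ shadowSet β i₀ IB hIB c₀) {i : ι}
    (hi : i ∈ IB) : c₀ ≤ β.coord i y :=
  hy.2.2.trans (Finset.inf'_le _ hi)

/-- All coordinates of a point of the shadow set (`c₀ ≥ 0`) are nonnegative. [folklore] -/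
theorem coord_nonneg_of_mem_shadowSet (hi₀ : i₀ ∉ IB) {c₀ : ℝ} (hc₀ : 0 ≤ c₀) {y : E}
    (hy : y ∈ shadowSet β i₀ IB hIB c₀) (i : ι) : 0 ≤ β.coord i y := by
  by_cases hiB : i ∈ IB
  · exact hc₀.trans (le_coord_of_mem_shadowSet hy hiB)
  by_cases hi : i = i₀
  · subst hi
    have h1 := β.sum_coord_apply_eq_one y
    rw [sum_univ_eq_apex_base_rest hi₀, Finset.sum_eq_zero fun j hj => hy.1 j
      (Finset.mem_sdiff.1 hj).2, add_zero] at h1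
    have h2 : coneLev β IB y ≤ 1 := hy.2.1
    rw [coneLev] at h2
    linarith
  · exact (hy.1 i (by rw [Finset.mem_insert, not_or]; exact ⟨hi, hiB⟩)).ge

/-- The shadow set lies in the closed simplex. [folklore] -/
theorem shadowSet_subset_convexHull (hi₀ : i₀ ∉ IB) {c₀ : ℝ} (hc₀ : 0 ≤ c₀) :
    shadowSet β i₀ IB hIB c₀ ⊆ convexHull ℝ (β '' ((insert i₀ IB : Finset ι) : Set ι)) :=
  fun _ hy => mem_convexHull_image_of_coord _ (coord_nonneg_of_mem_shadowSet hi₀ hc₀ hy) hy.1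

omit [Fintype ι] in
/-- The shadow set of positive depth misses every facet through the apex. [folklore] -/
theorem notMem_facet_of_mem_shadowSet (hi₀ : i₀ ∉ IB) {c₀ : ℝ} (hc₀ : 0 < c₀) {y : E}
    (hy : y ∈ shadowSet β i₀ IB hIB c₀) {b : ι} (hb : b ∈ IB) :
    y ∉ convexHull ℝ (β '' ((insert i₀ (IB.erase b) : Finset ι) : Set ι)) := fun h => by
  have hb' : b ∉ insert i₀ (IB.erase b) := by
    rw [Finset.mem_insert, not_or]
    exact ⟨fun h => hi₀ (h ▸ hb), Finset.notMem_erase b IB⟩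
  have h0 := coord_eq_zero_of_mem_convexHull_image hb' h
  have h1 := le_coord_of_mem_shadowSet hy hb
  linarith

/-- The shadow set is closed. [folklore] -/
theorem isClosed_shadowSet [FiniteDimensional ℝ E] (c₀ : ℝ) :
    IsClosed (shadowSet β i₀ IB hIB c₀) := by
  have h1 : IsClosed {y : E | ∀ i, i ∉ insert i₀ IB → β.coord i y = 0} := by
    have : {y : E | ∀ i, i ∉ insert i₀ IB → β.coord i y = 0} =
        ⋂ i ∈ (Finset.univ \ insert i₀ IB : Finset ι), {y | β.coord i y = 0} := by
      ext y
      simp only [mem_setOf_eq, mem_iInter, Finset.mem_sdiff, Finset.mem_univ, true_and]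
    rw [this]
    exact isClosed_biInter fun i _ => isClosed_eq (continuous_barycentric_coord β i) continuous_const
  simp only [shadowSet, Set.setOf_and]
  exact h1.inter ((isClosed_le continuous_coneLev continuous_const).inter
    (isClosed_le continuous_const (continuous_coneMin hIB)))

/-- The shadow set of nonnegative depth is compact. [folklore] -/
theorem isCompact_shadowSet [FiniteDimensional ℝ E] (hi₀ : i₀ ∉ IB) {c₀ : ℝ} (hc₀ : 0 ≤ c₀) :
    IsCompact (shadowSet β i₀ IB hIB c₀) := by
  refine Metric.isCompact_of_isClosed_isBounded (isClosed_shadowSet c₀)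
    ((Metric.isBounded_closedBall (x := β i₀) (r := baseSize β i₀ IB)).subset fun y hy => ?_)
  have h0 := coord_nonneg_of_mem_shadowSet hi₀ hc₀ hy
  rw [Metric.mem_closedBall, dist_eq_norm]
  have hdec := cone_decomp (β := β) hi₀ y
  rw [coneZ_eq_zero_of_coord hy.1, add_zero] at hdec
  have : y - β i₀ = coneW β i₀ IB y := by rw [hdec]; abel_nf; rw [← hdec]
  rw [this]
  calc ‖coneW β i₀ IB y‖ ≤ coneLev β IB y * baseSize β i₀ IB := norm_coneW_le fun i _ => h0 i
    _ ≤ 1 * baseSize β i₀ IB := mul_le_mul_of_nonneg_right hy.2.1 baseSize_nonneg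
    _ = baseSize β i₀ IB := one_mul _

/-! #### The shadow of a moved point -/

/-- **Shadow of a moved point.** A point at level `L ∈ (s₁, s₃)` with depth `> θ L` is within
`(s₃ - 1) R₀ + ‖coneZ x‖` of the shadow set of depth `θ s₁` (`s₁ ≤ 1 ≤ s₃`): drop the normal
part and rescale the cone vector to level `min L 1`. [folklore] -/
theorem exists_mem_shadowSet_dist_le (hi₀ : i₀ ∉ IB) (hs₁ : P.s₁ ≤ 1) (hs₃ : 1 ≤ P.s₃) {x : E}
    (h1 : P.s₁ < coneLev β IB x) (h2 : coneLev β IB x < P.s₃)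
    (h3 : P.θ * coneLev β IB x < coneMin β IB hIB x) :
    ∃ y ∈ shadowSet β i₀ IB hIB (P.θ * P.s₁),
      dist x y ≤ (P.s₃ - 1) * baseSize β i₀ IB + ‖coneZ β i₀ IB x‖ := by
  set L := coneLev β IB x with hL
  have hLpos : 0 < L := P.hs₁.trans h1
  set ρ : ℝ := min L 1 / L with hρ
  have hρpos : 0 < ρ := div_pos (lt_min hLpos one_pos) hLpos
  have hρle : ρ ≤ 1 := by rw [hρ, div_le_one hLpos]; exact min_le_left _ _
  have hρL : ρ * L = min L 1 := div_mul_cancel₀ _ hLpos.ne'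
  -- base coordinates of `x` are positive
  have hcoord : ∀ i ∈ IB, P.θ * L < β.coord i x := fun i hi =>
    h3.trans_le (Finset.inf'_le _ hi)
  have hθL : 0 < P.θ * L := mul_pos P.hθ hLpos
  refine ⟨β i₀ + ρ • coneW β i₀ IB x, ⟨fun i hi => ?_, ?_, ?_⟩, ?_⟩
  · rw [Finset.mem_insert, not_or] at hi
    rw [coord_apex_add_smul_coneW hi₀, if_neg hi.2, if_neg hi.1]
  · show coneLev β IB (β i₀ + ρ • coneW β i₀ IB x) ≤ 1
    rw [coneLev, Finset.sum_congr rfl fun i hi => by rw [coord_apex_add_smul_coneW hi₀, if_pos hi],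
      ← Finset.mul_sum, ← coneLev, ← hL, hρL]
    exact min_le_right _ _
  · show P.θ * P.s₁ ≤ coneMin β IB hIB (β i₀ + ρ • coneW β i₀ IB x)
    rw [coneMin]
    refine Finset.le_inf' hIB _ fun i hi => ?_
    rw [coord_apex_add_smul_coneW hi₀, if_pos hi]
    have hci := hcoord i hi
    have hmin : P.s₁ ≤ min L 1 := le_min h1.le hs₁
    calc P.θ * P.s₁ ≤ P.θ * min L 1 := mul_le_mul_of_nonneg_left hmin P.hθ.le
      _ = ρ * (P.θ * L) := by rw [← hρL]; ring
      _ ≤ ρ * β.coord i x := mul_le_mul_of_nonneg_left hci.le hρpos.le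
  · -- the distance
    have hdec := cone_decomp (β := β) hi₀ x
    have hdiff : x - (β i₀ + ρ • coneW β i₀ IB x) = (1 - ρ) • coneW β i₀ IB x + coneZ β i₀ IB x := by
      nth_rw 1 [hdec]
      module
    rw [dist_eq_norm, hdiff]
    have hW : ‖coneW β i₀ IB x‖ ≤ L * baseSize β i₀ IB :=
      norm_coneW_le fun i hi => (hθL.trans (hcoord i hi)).le
    have h1ρ : 0 ≤ 1 - ρ := sub_nonneg.2 hρle
    have hkey : (1 - ρ) * L ≤ P.s₃ - 1 := by
      rw [sub_mul, one_mul, hρL]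
      rcases le_or_gt L 1 with hL1 | hL1
      · rw [min_eq_left hL1]; linarith
      · rw [min_eq_right hL1.le]; linarith
    calc ‖(1 - ρ) • coneW β i₀ IB x + coneZ β i₀ IB x‖
        ≤ ‖(1 - ρ) • coneW β i₀ IB x‖ + ‖coneZ β i₀ IB x‖ := norm_add_le _ _
      _ = (1 - ρ) * ‖coneW β i₀ IB x‖ + ‖coneZ β i₀ IB x‖ := by
          rw [norm_smul, Real.norm_of_nonneg h1ρ]
      _ ≤ (1 - ρ) * (L * baseSize β i₀ IB) + ‖coneZ β i₀ IB x‖ := by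
          gcongr
      _ = ((1 - ρ) * L) * baseSize β i₀ IB + ‖coneZ β i₀ IB x‖ := by ring
      _ ≤ (P.s₃ - 1) * baseSize β i₀ IB + ‖coneZ β i₀ IB x‖ := by
          gcongr
          exact baseSize_nonneg

end Moved

/-! ### The simplex, its horn, and the covering property of the inverse push -/

section Cover

variable {E : Type*} [NormedAddCommGroup E] [NormedSpace ℝ E]
variable {ι : Type*} [Fintype ι] [DecidableEq ι]
variable {β : AffineBasis ι ℝ E} {i₀ : ι} {IB : Finset ι} {hIB : IB.Nonempty} {P : PushData}

variable (β i₀ IB) in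
/-- The closed simplex with apex `β i₀` over the base `β(IB)`. [folklore] -/
def coneSimplex : Set E := convexHull ℝ (β '' ((insert i₀ IB : Finset ι) : Set ι))

variable (β i₀ IB) in
/-- The **horn**: the union of the facets of the simplex through the apex (the facets opposite
to the base vertices) — what remains of the boundary after removing the free face `β(IB)`.
[folklore] -/
def coneHorn : Set E := ⋃ b ∈ IB, convexHull ℝ (β '' ((insert i₀ (IB.erase b) : Finset ι) : Set ι))

omit [Fintype ι] in
/-- The apex lies in the horn. [folklore] -/
theorem apex_mem_coneHorn (hIB : IB.Nonempty) : β i₀ ∈ coneHorn β i₀ IB := by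
  obtain ⟨b, hb⟩ := hIB
  refine mem_iUnion₂.2 ⟨b, hb, subset_convexHull ℝ _ ⟨i₀, ?_, rfl⟩⟩
  exact Finset.mem_coe.2 (Finset.mem_insert_self _ _)

omit [Fintype ι] in
/-- The horn is compact. [folklore] -/
theorem isCompact_coneHorn : IsCompact (coneHorn β i₀ IB) :=
  IB.isCompact_biUnion fun _ _ => ((Finset.finite_toSet _).image β).isCompact_convexHull ℝ

omit [Fintype ι] in
/-- Coordinates of points of the simplex: nonnegative, vanishing off `insert i₀ IB`. [folklore] -/
theorem coord_of_mem_coneSimplex {y : E} (hy : y ∈ coneSimplex β i₀ IB) :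
    (∀ i, 0 ≤ β.coord i y) ∧ ∀ i, i ∉ insert i₀ IB → β.coord i y = 0 :=
  ⟨fun i => coord_nonneg_of_mem_convexHull_image i hy,
    fun _ hi => coord_eq_zero_of_mem_convexHull_image hi hy⟩

/-- Coordinates of a point moved along `β b - β i₀`. [folklore] -/
theorem coord_add_smul_vertex_sub_apex (y : E) (t : ℝ) (b : ι) (i : ι) :
    β.coord i (y + t • (β b - β i₀)) =
      β.coord i y + (if i = b then t else 0) - (if i = i₀ then t else 0) := by
  let w' : ι → ℝ := fun i => β.coord i y + (if i = b then t else 0) - (if i = i₀ then t else 0)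
  have hw1 : ∑ i, w' i = 1 := by
    simp only [w', Finset.sum_sub_distrib, Finset.sum_add_distrib, Finset.sum_ite_eq',
      Finset.mem_univ, if_true, β.sum_coord_apply_eq_one]
    ring
  have hcomb : ∑ i, w' i • β i = y + t • (β b - β i₀) := by
    simp only [w', sub_smul, add_smul, Finset.sum_sub_distrib, Finset.sum_add_distrib, ite_smul,
      zero_smul, Finset.sum_ite_eq', Finset.mem_univ, if_true, β.linear_combination_coord_eq_self]
    module
  have hx' : y + t • (β b - β i₀) = Finset.univ.affineCombination ℝ β w' := by
    rw [Finset.affineCombination_eq_linear_combination _ _ _ hw1, hcomb]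
  rw [hx', β.coord_apply_combination_of_mem (Finset.mem_univ i) hw1]

/-- **Points of low level are near the apex**: a point with nonnegative coordinates vanishing
off `insert i₀ IB` and `coneLev · R₀ < κ` is within `κ` of the horn. [folklore] -/
theorem mem_of_coneLev_lt (hi₀ : i₀ ∉ IB) (hIB : IB.Nonempty) {O : Set E} {κ : ℝ}
    (hO : ∀ x, (∃ h ∈ coneHorn β i₀ IB, dist x h < κ) → x ∈ O) {y : E}
    (h0 : ∀ i, 0 ≤ β.coord i y) (hS : ∀ i, i ∉ insert i₀ IB → β.coord i y = 0)
    (hlt : coneLev β IB y * baseSize β i₀ IB < κ) : y ∈ O := by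
  refine hO y ⟨β i₀, apex_mem_coneHorn hIB, ?_⟩
  have hdec := cone_decomp (β := β) hi₀ y
  rw [coneZ_eq_zero_of_coord hS, add_zero] at hdec
  have : y - β i₀ = coneW β i₀ IB y := by nth_rw 1 [hdec]; abel
  rw [dist_eq_norm, this]
  exact (norm_coneW_le fun i _ => h0 i).trans_lt hlt

/-- **Points of low depth are near the horn**: a point with nonnegative coordinates vanishing
off `insert i₀ IB` and `coneMin · R₀ < κ` is within `κ` of the facet opposite to a deepest base
vertex. [folklore] -/
theorem mem_of_coneMin_lt (hi₀ : i₀ ∉ IB) {O : Set E} {κ : ℝ}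
    (hO : ∀ x, (∃ h ∈ coneHorn β i₀ IB, dist x h < κ) → x ∈ O) {y : E}
    (h0 : ∀ i, 0 ≤ β.coord i y) (hS : ∀ i, i ∉ insert i₀ IB → β.coord i y = 0)
    (hlt : coneMin β IB hIB y * baseSize β i₀ IB < κ) : y ∈ O := by
  obtain ⟨b₀, hb₀, hmin⟩ := Finset.exists_mem_eq_inf' hIB fun i => β.coord i y
  have hb₀i : b₀ ≠ i₀ := fun h => hi₀ (h ▸ hb₀)
  set c := β.coord b₀ y with hc
  have hc0 : 0 ≤ c := h0 b₀
  set h : E := y + (-c) • (β b₀ - β i₀) with hh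
  have hcoord : ∀ i, β.coord i h =
      β.coord i y + (if i = b₀ then -c else 0) - (if i = i₀ then -c else 0) :=
    coord_add_smul_vertex_sub_apex y (-c) b₀
  have hmem : h ∈ coneHorn β i₀ IB := by
    refine mem_iUnion₂.2 ⟨b₀, hb₀, mem_convexHull_image_of_coord _ (fun i => ?_) (fun i hi => ?_)⟩
    · rw [hcoord]
      by_cases hib : i = b₀
      · subst hib; rw [if_pos rfl, if_neg hb₀i, ← hc]; ring_nf; exact le_rfl
      · rw [if_neg hib]
        by_cases hii : i = i₀
        · rw [if_pos hii]; linarith [h0 i]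
        · rw [if_neg hii]; linarith [h0 i]
    · rw [hcoord]
      rw [Finset.mem_insert, not_or, Finset.mem_erase, not_and_or, not_not] at hi
      obtain ⟨hii, hi'⟩ := hi
      rw [if_neg hii]
      rcases hi' with hib | hiB
      · rw [if_pos hib, hib, ← hc]; ring
      · have hib : i ≠ b₀ := fun h => hiB (h ▸ hb₀)
        rw [if_neg hib, hS i (by rw [Finset.mem_insert, not_or]; exact ⟨hii, hiB⟩)]; ring
  refine hO y ⟨h, hmem, ?_⟩
  have hdist : dist y h = c * ‖β b₀ - β i₀‖ := by
    rw [dist_eq_norm, hh, neg_smul, ← sub_eq_add_neg, sub_sub_cancel, norm_smul,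
      Real.norm_of_nonneg hc0]
  rw [hdist]
  calc c * ‖β b₀ - β i₀‖ ≤ c * baseSize β i₀ IB :=
        mul_le_mul_of_nonneg_left (norm_sub_apex_le_baseSize hb₀) hc0
    _ = coneMin β IB hIB y * baseSize β i₀ IB := by rw [hc, coneMin, hmin]
    _ < κ := hlt

/-- **The covering property.** If the `κ`-neighbourhood of the horn lies in `O`, the levels
`≤ 2 s₁` and the depths `≤ 2θ` are within `κ` (`2 s₁ R₀ < κ`, `2 θ R₀ < κ`), `s₁ ≤ 1 ≤ vf`, then
the backward push carries every point of the simplex into `O`; equivalently the forward push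
of `O` covers the simplex. [folklore] -/
theorem pushMap_bwd_mem (hi₀ : i₀ ∉ IB) {O : Set E} {κ : ℝ}
    (hO : ∀ x, (∃ h ∈ coneHorn β i₀ IB, dist x h < κ) → x ∈ O) (hvf : 1 ≤ P.vf)
    (h2s : 2 * P.s₁ * baseSize β i₀ IB < κ) (h2θ : 2 * P.θ * baseSize β i₀ IB < κ) {y : E}
    (hy : y ∈ coneSimplex β i₀ IB) : pushMap β i₀ IB hIB P (bwdLevel P) y ∈ O := by
  obtain ⟨h0, hS⟩ := coord_of_mem_coneSimplex hy
  have hR : 0 ≤ baseSize β i₀ IB := baseSize_nonneg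
  have hκ : 0 < κ := lt_of_le_of_lt (by positivity [P.hs₁.le]) h2s
  set L := coneLev β IB y with hL
  have hL0 : 0 ≤ L := Finset.sum_nonneg fun i _ => h0 i
  have hL1 : L ≤ 1 := coneLev_le_one_of_coord_nonneg h0
  rcases le_or_gt L P.s₁ with hLs | hLs
  · -- low level: nothing moves, and `y` is near the apex
    rw [pushMap_eq_self_of_coneLev_le (Φ := bwdLevel P) (fun v => plProfile_of_le_one le_rfl) hLs]
    refine mem_of_coneLev_lt hi₀ hIB hO h0 hS ?_
    calc coneLev β IB y * baseSize β i₀ IB ≤ P.s₁ * baseSize β i₀ IB :=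
          mul_le_mul_of_nonneg_right hLs hR
      _ < κ := by nlinarith [P.hs₁]
  · -- the pushed point `y' = y + (r' - 1) • coneW y`
    set v := pushVal β i₀ IB hIB P y with hv
    have hvmem := pushVal_mem (β := β) (i₀ := i₀) (IB := IB) (hIB := hIB) (P := P) y
    have hv₁ : P.s₁ < v := P.s₁_lt_s₂.trans_le hvmem.1
    have hv₃ : v < P.s₃ := hvmem.2.trans_lt P.vf_lt_s₃
    have hlvl : pushLvl β IB P y = L := pushLvl_eq_of_lt hLs
    set L' := bwdLevel P v L with hL'
    have hL'gt : P.s₁ < L' := lt_plProfile hv₁ hv₃ P.s₁_lt_s₂ P.s₂_lt_s₃ hLs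
    have hL'le : L' ≤ L := plProfile_le_self hv₁ hv₃ P.s₁_lt_s₂.le hvmem.1 L
    have hLpos : 0 < L := P.hs₁.trans hLs
    set r : ℝ := L' / L with hr
    have hr0 : 0 < r := div_pos (P.hs₁.trans hL'gt) hLpos
    have hr1 : r ≤ 1 := (div_le_one hLpos).2 hL'le
    have hrL : r * L = L' := div_mul_cancel₀ _ hLpos.ne'
    have hy' : pushMap β i₀ IB hIB P (bwdLevel P) y = y + (r - 1) • coneW β i₀ IB y := by
      rw [pushMap, hlvl]
    rw [hy']
    -- coordinates of the pushed point
    have h0' : ∀ i, 0 ≤ β.coord i (y + (r - 1) • coneW β i₀ IB y) := fun i => by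
      rw [coord_add_smul_coneW hi₀]
      split_ifs with h1 h2
      · exact mul_nonneg hr0.le (h0 i)
      · rw [← hL]; nlinarith [h0 i₀]
      · exact h0 i
    have hS' : ∀ i, i ∉ insert i₀ IB → β.coord i (y + (r - 1) • coneW β i₀ IB y) = 0 := by
      intro i hi
      rw [Finset.mem_insert, not_or] at hi
      rw [coord_add_smul_coneW hi₀, if_neg hi.2, if_neg hi.1]
      exact hS i (by rw [Finset.mem_insert, not_or]; exact hi)
    rcases le_or_gt (2 * P.θ * L) (coneMin β IB hIB y) with hdeep | hshallow
    · -- deep: full strength, the new level is `≤ s₂`, near the apex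
      have hlam : pushLam β i₀ IB hIB P y = 1 := by
        have h1 : pushLam₁ β IB hIB P y = 1 := by
          rw [pushLam₁, hlvl]
          have ht : 1 ≤ (coneMin β IB hIB y / L - P.θ) / P.θ := by
            rw [le_div_iff₀ P.hθ, one_mul, le_sub_iff_add_le, le_div_iff₀ hLpos]
            linarith
          rw [min_eq_left ht, max_eq_right zero_le_one]
        have h2 : pushLam₂ β i₀ IB P y = 1 := by
          rw [pushLam₂, coneZ_eq_zero_of_coord hS, norm_zero, sub_zero]
          have ht : (1 : ℝ) ≤ 2 * P.ζ / P.ζ := by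
            rw [le_div_iff₀ P.hζ]; linarith [P.hζ]
          rw [min_eq_left ht, max_eq_right zero_le_one]
        rw [pushLam, h1, h2, mul_one]
      have hvf' : v = P.vf := by rw [hv, pushVal, hlam]; ring
      have hL's : L' ≤ P.s₂ := by
        rw [hL', bwdLevel, hvf']
        have hmono := (strictMono_plProfile P.s₁_lt_vf P.vf_lt_s₃ P.s₁_lt_s₂ P.s₂_lt_s₃).monotone
          (hL1.trans hvf)
        rwa [plProfile_two P.s₁_lt_vf] at hmono
      refine mem_of_coneLev_lt hi₀ hIB hO h0' hS' ?_
      rw [coneLev_add_smul_coneW hi₀, ← hL, hrL]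
      calc L' * baseSize β i₀ IB ≤ P.s₂ * baseSize β i₀ IB := mul_le_mul_of_nonneg_right hL's hR
        _ = 2 * P.s₁ * baseSize β i₀ IB := by rw [PushData.s₂]
        _ < κ := h2s
    · -- shallow: the depth only decreases, near the horn
      refine mem_of_coneMin_lt (hIB := hIB) hi₀ hO h0' hS' ?_
      rw [coneMin_add_smul_coneW hi₀ hIB y hr0.le]
      have hmin0 : 0 ≤ coneMin β IB hIB y := Finset.le_inf' hIB _ fun i _ => h0 i
      calc r * coneMin β IB hIB y * baseSize β i₀ IB ≤ 1 * coneMin β IB hIB y * baseSize β i₀ IB := by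
            gcongr
        _ ≤ 2 * P.θ * L * baseSize β i₀ IB := by
            rw [one_mul]; exact mul_le_mul_of_nonneg_right hshallow.le hR
        _ ≤ 2 * P.θ * 1 * baseSize β i₀ IB := by gcongr; linarith [P.hθ]
        _ < κ := by rw [mul_one]; exact h2θ

end Cover

/-! ### The stretch across a simplex from its free face -/

section Stretch

variable {E : Type*} [NormedAddCommGroup E] [NormedSpace ℝ E] [FiniteDimensional ℝ E]
variable {ι : Type*} [Fintype ι] [DecidableEq ι]
variable {β : AffineBasis ι ℝ E} {i₀ : ι} {IB : Finset ι}

/-- **Stretching an open set across a simplex from a free face** (Rushing, Exercise 1.6.12, the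
case of one elementary collapse; homeomorphism form).  Let `Δ` be the simplex with apex `β i₀`
over the base `β(IB)` (vertices of an affine basis `β` of `E`) and `H` its horn (the facets
through the apex).  Let `F` be a closed set meeting `Δ` only inside `H`, let `O` be an open set
containing `H`, and `N` an open set containing `Δ`.  Then there is a self-homeomorphism `G` of
`E`, equal to the identity on `F` and outside a compact subset of `N`, with `Δ ⊆ G(O)`.
Construction: the push along the cone lines from the apex (`pushHomeomorph`) with parameters
`s₁ = min (1/4) (κ/4R)`, `θ = κ/4R` from a `κ`-thickening of `H` inside `O` (so that the full
push, active at depth `≥ 2θ`, pulls every point of `Δ` back to level `≤ 2 s₁`, within `κ` of the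
apex, and the damped pushes only decrease the depth of shallow points, which are within `κ` of
`H`), and `vf = 1 + mg`, `mg = g/4R`, `ζ = g/4` from a `g`-thickening of the shadow set of
depth `θ s₁` inside `N ∖ F` (so that every moved point is within `g` of the shadow set).
[cite: Rushing1973, Exercise 1.6.12] -/
theorem exists_homeomorph_coneSimplex_subset_image (hi₀ : i₀ ∉ IB) (hIB : IB.Nonempty)
    {F O N : Set E} (hF : IsClosed F)
    (hFΔ : ∀ x ∈ F, x ∈ coneSimplex β i₀ IB → x ∈ coneHorn β i₀ IB)
    (hO : IsOpen O) (hHO : coneHorn β i₀ IB ⊆ O) (hN : IsOpen N) (hΔN : coneSimplex β i₀ IB ⊆ N) :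
    ∃ G : E ≃ₜ E, (∀ x ∈ F, G x = x) ∧
      (∃ C : Set E, IsCompact C ∧ C ⊆ N ∧ ∀ x, x ∉ C → G x = x) ∧ coneSimplex β i₀ IB ⊆ G '' O := by
  -- a `κ`-neighbourhood of the horn inside `O`
  obtain ⟨κ, hκ, hthick⟩ := (isCompact_coneHorn (β := β) (i₀ := i₀) (IB := IB)).exists_thickening_subset_open hO hHO
  have hO' : ∀ x, (∃ h ∈ coneHorn β i₀ IB, dist x h < κ) → x ∈ O := fun x hx =>
    hthick (mem_thickening_iff.2 hx)
  set R₀ := baseSize β i₀ IB with hR₀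
  have hR₀ : 0 ≤ R₀ := baseSize_nonneg
  set R : ℝ := R₀ + 1 with hR
  have hRpos : 0 < R := by positivity
  have hR₀R : R₀ < R := by linarith
  -- levels and depths
  set θ : ℝ := κ / (4 * R) with hθ
  have hθpos : 0 < θ := by positivity
  set s₁ : ℝ := min (1 / 4) θ with hs₁
  have hs₁pos : 0 < s₁ := lt_min (by norm_num) hθpos
  have hs₁le : s₁ ≤ 1 / 4 := min_le_left _ _
  have hs₁θ : s₁ ≤ θ := min_le_right _ _
  have hθR : θ * R = κ / 4 := by rw [hθ]; field_simp
  have h2θ : 2 * θ * R₀ < κ := by nlinarith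
  have h2s : 2 * s₁ * R₀ < κ := by nlinarith
  -- the shadow set and its `g`-neighbourhood inside `N ∖ F`
  set K := shadowSet β i₀ IB hIB (θ * s₁) with hK
  have hc₀ : 0 < θ * s₁ := mul_pos hθpos hs₁pos
  have hKcpt : IsCompact K := isCompact_shadowSet hi₀ hc₀.le
  have hKsub : K ⊆ N ∩ Fᶜ := fun y hy => by
    have hyΔ : y ∈ coneSimplex β i₀ IB := shadowSet_subset_convexHull hi₀ hc₀.le hy
    refine ⟨hΔN hyΔ, fun hyF => ?_⟩
    obtain ⟨b, hb, hyb⟩ := mem_iUnion₂.1 (hFΔ y hyF hyΔ)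
    exact notMem_facet_of_mem_shadowSet hi₀ hc₀ hy hb hyb
  obtain ⟨g, hg, hgsub⟩ := hKcpt.exists_cthickening_subset_open (hN.inter hF.isOpen_compl) hKsub
  -- the remaining parameters
  set mg : ℝ := g / (4 * R) with hmg
  have hmgpos : 0 < mg := by positivity
  set ζ : ℝ := g / 4 with hζ
  have hζpos : 0 < ζ := by positivity
  have hmgR : mg * R = g / 4 := by rw [hmg]; field_simp
  let P : PushData :=
    { s₁ := s₁, vf := 1 + mg, mg := mg, θ := θ, ζ := ζ,
      hs₁ := hs₁pos, hvf := by linarith, hmg := hmgpos, hθ := hθpos, hζ := hζpos }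
  have hPs₃ : P.s₃ = 1 + 2 * mg := by show (1 + mg) + mg = 1 + 2 * mg; ring
  have hgap : (P.s₃ - 1) * R₀ + 2 * P.ζ < g := by
    rw [hPs₃]
    show (1 + 2 * mg - 1) * R₀ + 2 * ζ < g
    nlinarith
  set G : E ≃ₜ E := pushHomeomorph (β := β) (i₀ := i₀) (IB := IB) (hIB := hIB) (P := P) hi₀ with hG
  have hGapply : ∀ x, G x = pushMap β i₀ IB hIB P (fwdLevel P) x := fun x => rfl
  have hGsymm : ∀ x, G.symm x = pushMap β i₀ IB hIB P (bwdLevel P) x := fun x => rfl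
  -- moved points are within `g` of the shadow set
  set C : Set E := cthickening g K with hC
  have hmoved : ∀ x, G x ≠ x → x ∈ C := by
    intro x hx
    rw [hGapply] at hx
    obtain ⟨h1, h2, h3, h4⟩ := moved_fwd hx
    obtain ⟨y, hyK, hdist⟩ := exists_mem_shadowSet_dist_le (P := P) hi₀
      (hs₁le.trans (by norm_num)) (by rw [hPs₃]; linarith) h1 h2 h3
    refine mem_cthickening_of_dist_le x y g K hyK (hdist.trans ?_)
    have : ‖coneZ β i₀ IB x‖ ≤ 2 * P.ζ := h4.le
    linarith
  refine ⟨G, fun x hxF => ?_, ⟨C, hKcpt.cthickening, ?_, fun x hx => ?_⟩, fun y hy => ?_⟩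
  · by_contra h
    exact (hgsub (hmoved x h)).2 hxF
  · exact fun x hx => (hgsub hx).1
  · by_contra h
    exact hx (hmoved x h)
  · refine ⟨G.symm y, ?_, G.apply_symm_apply y⟩
    rw [hGsymm]
    exact pushMap_bwd_mem hi₀ hO' (by show (1 : ℝ) ≤ 1 + mg; linarith) h2s h2θ hy


/-- **Stretching an open set across a simplex from a free face, for a simplex given by its
vertices** (Rushing, Exercise 1.6.12, one elementary collapse; homeomorphism form).  Let
`T ⊆ E` be an affinely independent finite set, `a ∈ T`, `B = T ∖ {a}` nonempty (the free
face), `Δ = conv T`, and `H = ⋃_{b ∈ B} conv (T ∖ {b})` the union of the facets through `a`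
(`= a * ∂B`, so that `Δ ↘ H` is the elementary collapse across `Δ` from `B`).  If `F` is closed
with `F ∩ Δ ⊆ H`, `O ⊇ H` is open and `N ⊇ Δ` is open, there is a self-homeomorphism `G` of `E`,
the identity on `F` and off a compact subset of `N`, with `Δ ⊆ G(O)`.  (Reduction to
`exists_homeomorph_coneSimplex_subset_image` by extending `T` to an affine basis of `E`.)
[cite: Rushing1973, Exercise 1.6.12] -/
theorem exists_homeomorph_convexHull_subset_image [DecidableEq E] {T : Finset E}
    (hT : AffineIndependent ℝ ((↑) : T → E)) {a : E} (ha : a ∈ T) (hB : (T.erase a).Nonempty)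
    {F O N : Set E} (hF : IsClosed F)
    (hFΔ : ∀ x ∈ F, x ∈ convexHull ℝ (T : Set E) →
      x ∈ ⋃ b ∈ T.erase a, convexHull ℝ ((T.erase b : Finset E) : Set E))
    (hO : IsOpen O) (hHO : (⋃ b ∈ T.erase a, convexHull ℝ ((T.erase b : Finset E) : Set E)) ⊆ O)
    (hN : IsOpen N) (hΔN : convexHull ℝ (T : Set E) ⊆ N) :
    ∃ G : E ≃ₜ E, (∀ x ∈ F, G x = x) ∧
      (∃ C : Set E, IsCompact C ∧ C ⊆ N ∧ ∀ x, x ∉ C → G x = x) ∧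
      convexHull ℝ (T : Set E) ⊆ G '' O := by
  -- extend `T` to an affine basis `β` of `E`, indexed by a finite set `t ⊇ T`
  obtain ⟨t, hTt, ht, htop⟩ :=
    exists_subset_affineIndependent_affineSpan_eq_top (k := ℝ) (s := (T : Set E)) hT
  haveI : Fintype t := (finite_set_of_fin_dim_affineIndependent ℝ ht).fintype
  let β : AffineBasis t ℝ E := ⟨(↑), ht, by rw [Subtype.range_coe]; exact htop⟩
  have hβ : ∀ i : t, β i = (i : E) := fun i => rfl
  set i₀ : t := ⟨a, hTt (Finset.mem_coe.2 ha)⟩ with hi₀def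
  set IB : Finset t := Finset.univ.filter fun i => (i : E) ∈ T.erase a with hIBdef
  have hmemIB : ∀ i : t, i ∈ IB ↔ (i : E) ∈ T.erase a := fun i => by simp [hIBdef]
  have hi₀ : i₀ ∉ IB := fun h => by
    have h' := (hmemIB i₀).1 h
    simp [hi₀def] at h'
  have hIB : IB.Nonempty := by
    obtain ⟨b, hb⟩ := hB
    exact ⟨⟨b, hTt (Finset.mem_coe.2 (Finset.mem_of_mem_erase hb))⟩, (hmemIB _).2 hb⟩
  -- the vertex sets
  have himg₁ : β '' ((insert i₀ IB : Finset t) : Set t) = (T : Set E) := by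
    ext x
    simp only [mem_image, Finset.coe_insert, mem_insert_iff, Finset.mem_coe, hmemIB, hβ]
    constructor
    · rintro ⟨i, hi | hi, rfl⟩
      · rw [hi]; exact ha
      · exact Finset.mem_of_mem_erase hi
    · intro hx
      by_cases hxa : x = a
      · exact ⟨i₀, Or.inl rfl, hxa.symm⟩
      · exact ⟨⟨x, hTt (Finset.mem_coe.2 hx)⟩, Or.inr (Finset.mem_erase.2 ⟨hxa, hx⟩), rfl⟩
  have himg₂ : ∀ b ∈ IB, β '' ((insert i₀ (IB.erase b) : Finset t) : Set t) =
      ((T.erase (b : E) : Finset E) : Set E) := by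
    intro b hb
    have hb' := (hmemIB b).1 hb
    obtain ⟨hba, hbT⟩ := Finset.mem_erase.1 hb'
    ext x
    simp only [mem_image, Finset.coe_insert, mem_insert_iff, Finset.mem_coe, Finset.mem_erase,
      hmemIB, hβ]
    constructor
    · rintro ⟨i, hi | ⟨hib, hia, hiT⟩, rfl⟩
      · rw [hi]; exact ⟨fun h => hba h.symm, ha⟩
      · exact ⟨fun h => hib (Subtype.ext h), hiT⟩
    · rintro ⟨hxb, hxT⟩
      by_cases hxa : x = a
      · exact ⟨i₀, Or.inl rfl, hxa.symm⟩
      · refine ⟨⟨x, hTt (Finset.mem_coe.2 hxT)⟩, Or.inr ⟨fun h => hxb ?_, hxa, hxT⟩, rfl⟩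
        rw [← h]
  have hΔ : coneSimplex β i₀ IB = convexHull ℝ (T : Set E) := by rw [coneSimplex, himg₁]
  have hH : coneHorn β i₀ IB = ⋃ b ∈ T.erase a, convexHull ℝ ((T.erase b : Finset E) : Set E) := by
    apply Subset.antisymm
    · intro x hx
      obtain ⟨b, hb, hxb⟩ := mem_iUnion₂.1 hx
      rw [himg₂ b hb] at hxb
      exact mem_iUnion₂.2 ⟨(b : E), (hmemIB b).1 hb, hxb⟩
    · intro x hx
      obtain ⟨b, hb, hxb⟩ := mem_iUnion₂.1 hx
      set b' : t := ⟨b, hTt (Finset.mem_coe.2 (Finset.mem_of_mem_erase hb))⟩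
      have hb' : b' ∈ IB := (hmemIB b').2 hb
      refine mem_iUnion₂.2 ⟨b', hb', ?_⟩
      rw [himg₂ b' hb']
      exact hxb
  -- apply the basis form
  obtain ⟨G, hGF, hGC, hGO⟩ := exists_homeomorph_coneSimplex_subset_image (β := β) hi₀ hIB hF
    (fun x hxF hxΔ => by rw [hH]; rw [hΔ] at hxΔ; exact hFΔ x hxF hxΔ) hO (by rw [hH]; exact hHO)
    hN (by rw [hΔ]; exact hΔN)
  rw [hΔ] at hGO
  exact ⟨G, hGF, hGC, hGO⟩

end Stretch

end SimplexStretch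

end Literature.Topology.FourManifolds
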